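import Mathlib
import HarnessLib
import Summits.HubbardSuperconductivity.HubbardSuperconductivity.Theorems.KLProgrammeKLRegimeEngineTowerImportXFloorPlain

/-!
# Route `KLProgramme` — crux K3 ENGINE (stmt-HubbardSuperconductivity-20437 `KLRegimeEngineV17F2`), stub (b) v2 (ℓ), the read-out's SIX-LEG LEVEL-ONE CELL `hsix`
# FROM THE ALL-FIXED / PLAIN SIX-LEG LINE OF `𝒱_j[K]` (cell gate-hubbard-kl, seat hubbard-kl-k3c2-p3 g15, row «sector-counting import»)

WHY.  The per-level closer of «(ℓ)-READOUT-F» (`kernelNormsLevels_readoutF_of_blocks_link`, p690127; `…_klEng`, p690813) carries, besides the per-block import rows, ONE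
cell at the read-out level `j` that the tower does not produce (track `0` at six legs is imported at every block, the read-out block included):
`hsix : ∀ Ωe, levelCount Ωe = 1 → klAnisoLegKernelNormAt … klE0 j (2·3) Ωe ≤ CE³·ε_j²·2^{4j}`.  Since `klAnisoLegKernelNormAt … j 6 Ωe = klLevNormOf … j 6 (𝒱_j[K]) Ωe`
(`klLevNormOf_klEffectiveAction`, rfl), this is (one-anchor six-leg count `≤ klThinCount6C·|SectorLeg (sectorCount j)|⁴ = klThinCount6C·4096·2^{4j}`,
`card_bgmSectorSet_klAniso_six_anchored_le_doors`, p689804) × (all-fixed anisotropic six-leg pinned line `B₆` of `𝒱_j[K]` at `F_j`), and `B₆ ≤ CA⁶·S₆` from the PLAIN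
six-leg line (`fixedTupleL1_klAniso_le_of_plain_klEng_legs`, `pinnedSum_le_of_fixedTupleL1_le_legs`, p690921) — the `2^{4j}` of `hsix` IS the count's:

* **`klAnisoLegKernelNormAt_six_le_of_line_doors`** — six doors + all-fixed line `B₆` ⇒ `klAnisoLegKernelNormAt … klE0 j 6 Ωe ≤ 4096·klThinCount6C·2^{4j}·B₆` (every `Ωe`);
* **`klAnisoLegKernelNormAt_six_le_of_plainLine_klEng`** — `∃ CA > 0`: stub binders + six doors, `1 ≤ j ≤ nScales β + 1`, plain line `S₆` ⇒ `≤ 4096·klThinCount6C·2^{4j}·(CA⁶·S₆)`;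
* **`hsix_of_plainLine_klEng`** — the same in the closer's binder shape: if moreover `4096·klThinCount6C·(CA⁶·S₆) ≤ Qe.CE³·(epsCoupling P U j)²` then
  `∀ Ωe, levelCount Ωe = 1 → klAnisoLegKernelNormAt … klE0 j (2·3) Ωe ≤ Qe.CE³·(epsCoupling P U j)²·2^{(4:ℤ)·j}` verbatim.
Proofs only (compositions of landed theorems); the plain six-leg line `S₆` of `𝒱_j[K]` stays a hypothesis (E1's producer target); nothing asserts (ℓ), any stub, K3 or
superconductivity.  References: BGM 2006 §2.7 (2.71a), §2.8 (2.76)–(2.80), (2.96)–(2.98), Lemma 2.5 [cite: BenfattoGiulianiMastropietro2006].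
-/

noncomputable section

namespace Summit.HubbardSuperconductivity.HubbardSuperconductivity.Theorems.EngineV8

set_option linter.dupNamespace false -- summit = problem name (single-conjunct summit), D-0017

open Classical
open Real Finset Literature.MathematicalPhysics.QuantumLattice Literature.Probability.LatticeModels GrassmannAlgebra
open Literature.MathematicalPhysics.QuantumLattice.FermiRG
open Summit.HubbardSuperconductivity.HubbardSuperconductivity.Theorems.KLRegimeSplit
open Summit.HubbardSuperconductivity.HubbardSuperconductivity.Theorems.KLProgrammeLegKernels
open Summit.HubbardSuperconductivity.HubbardSuperconductivity.Theorems.DispersionFlow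
open Summit.HubbardSuperconductivity.HubbardSuperconductivity.Theorems.KLRegimeWick

variable {L M : ℕ} [NeZero L] [NeZero M]

omit [NeZero M] in
/-- **THE SIX-LEG LEVELLED NORM OF `𝒱_j[K]` FROM THE ALL-FIXED LINE, UNDER THE SIX DOORS**: for `R` with `0 ≤ R.Gfr j'`, `0 < c ≤ klThinCount6C₃ R`, `0 < U ≤ klThinCount6U₀ R`,
`klBetaMin ≤ β ≤ e^{c/U²}`, `μ ∈ klWindowC`, a frame with `FrameOK R U (nScales β) ν K`, and an all-fixed anisotropic six-leg pinned line `B₆ ≥ 0` of `𝒱_j[K]` sectorised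
with `F_j`: `klAnisoLegKernelNormAt L M β U μ K klE0 j 6 Ωe ≤ 4096·klThinCount6C·2^{4j}·B₆` for EVERY prescription `Ωe`.
[cite: BenfattoGiulianiMastropietro2006, §2.8 (2.76)-(2.80), (2.96)-(2.98), Lemma 2.5] -/
theorem klAnisoLegKernelNormAt_six_le_of_line_doors {R : RenConsts} (hR : ∀ j', 0 ≤ R.Gfr j') {c : ℝ} (hc : 0 < c)
    (hc₃ : c ≤ klThinCount6C₃ R) {U : ℝ} (hU : 0 < U) (hU₀ : U ≤ klThinCount6U₀ R) {β : ℝ} (hβ : klBetaMin ≤ β) (hβc : β ≤ Real.exp (c / U ^ 2))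
    {μ : ℝ} (hμ : μ ∈ klWindowC) (ν : ℝ) {K : TrigPolyC4v} (hK : FrameOK R U (nScales β) ν K) (j : ℕ) {B₆ : ℝ} (hB : 0 ≤ B₆)
    (hline : ∀ Ω ∈ bgmSectorSet L M (klAnisoFamily L M β μ K klE0 j) 6, ∀ (p : Fin 6) (x : SpaceTimeIdx L M),
      imagTimeWeight β M ^ 5 * ∑ X ∈ univ.filter (fun X : Fin 6 → SpaceTimeIdx L M => X p = x),
        ‖sectorisedKernel L M β (klAnisoFamily L M β μ K klE0 j) (klEffectiveAction L M β U μ K klE0 j) 6 Ω X‖ ≤ B₆)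
    (Ωe : Fin 6 → Option (SectorLeg (sectorCount j))) :
    klAnisoLegKernelNormAt L M β U μ K klE0 j 6 Ωe ≤ 4096 * klThinCount6C * (2 : ℝ) ^ (4 * j) * B₆ := by
  have hβ0 : 0 < β := KLRegimeSplit.pos_of_klBetaMin_le hβ
  have hC : 0 ≤ klThinCount6C := klThinCount6C_pos.le
  have hcard : (Fintype.card (SectorLeg (sectorCount j)) : ℝ) ^ 4 = 4096 * (2 : ℝ) ^ (4 * j) := by
    rw [card_sectorLeg_sectorCount, mul_pow, ← pow_mul, mul_comm j 4]; norm_num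
  have hNc : 0 ≤ klThinCount6C * (Fintype.card (SectorLeg (sectorCount j)) : ℝ) ^ 4 := by positivity
  rw [← klLevNormOf_klEffectiveAction]
  have h := klLevNormOf_six_le_card_mul hβ0.le μ K j (klEffectiveAction L M β U μ K klE0 j) Ωe hNc hB
    (fun p s => card_bgmSectorSet_klAniso_six_anchored_le_doors hR hc hc₃ hU hU₀ hβ hβc hμ ν hK L M j p s) hline
  rw [hcard] at h
  linarith [h]

/-- **THE SIX-LEG LEVELLED NORM OF `𝒱_j[K]` FROM THE PLAIN SIX-LEG LINE, UNDER THE STUB BINDERS**: `∃ CA > 0` absolute such that, under the stub binders (`P.WF`,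
`R.WF2`, `c ≤ klEngC₃6`, `U ≤ klEngU₀9`, `klEngL₃`, `klEngM₃`, `FrameOK R U (nScales β) μ K`) and the six-count doors (`c ≤ klThinCount6C₃ R`, `U ≤ klThinCount6U₀ R`), for every
level `1 ≤ j ≤ nScales β + 1` and `S₆ ≥ 0`: if for all spin/charge strings and every pin the plain six-leg kernel of `𝒱_j[K]` has `fixedTupleL1 β 5 … ≤ S₆`, then
`klAnisoLegKernelNormAt L M β U μ K klE0 j 6 Ωe ≤ 4096·klThinCount6C·2^{4j}·(CA⁶·S₆)` for every `Ωe`.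
[cite: BenfattoGiulianiMastropietro2006, §2.7 (2.71a), §2.8 (2.76)-(2.80), (2.96)-(2.98), Lemma 2.5] -/
theorem klAnisoLegKernelNormAt_six_le_of_plainLine_klEng :
    ∃ CA : ℝ, 0 < CA ∧ ∀ (P : SplitConsts) (R : RenConsts) (c : ℝ), P.WF → R.WF2 → 0 < c → c ≤ klEngC₃6 P R → c ≤ klThinCount6C₃ R →
      ∀ μ ∈ klWindowC, ∀ U : ℝ, 0 < U → U ≤ klEngU₀9 P R c → U ≤ klThinCount6U₀ R → ∀ β : ℝ, klBetaMin ≤ β → β ≤ Real.exp (c / U ^ 2) →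
      ∀ K : TrigPolyC4v, FrameOK R U (nScales β) μ K → ∀ (L M : ℕ) [NeZero L] [NeZero M],
      klEngL₃ β U ≤ L → klEngM₃ β U L ≤ M → ∀ j : ℕ, 1 ≤ j → j ≤ nScales β + 1 →
        ∀ S₆ : ℝ, 0 ≤ S₆ →
          (∀ (s c' : Fin 6 → Fin 2) (y₀ : SpaceTimeIdx L M),
            fixedTupleL1 L M β 5 (sectorisedKernel L M β (trivialMultiplier L M) (klEffectiveAction L M β U μ K klE0 j) 6)
              (fun i => (((0 : Fin 1), s i), c' i)) y₀ ≤ S₆) →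
          ∀ Ωe : Fin 6 → Option (SectorLeg (sectorCount j)),
            klAnisoLegKernelNormAt L M β U μ K klE0 j 6 Ωe ≤ 4096 * klThinCount6C * (2 : ℝ) ^ (4 * j) * (CA ^ 6 * S₆) := by
  obtain ⟨CA, hCA, h⟩ := fixedTupleL1_klAniso_le_of_plain_klEng_legs
  refine ⟨CA, hCA, ?_⟩
  intro P R c hP hR2 hc hc6 hcT6 μ hμ U hU hU9 hUT6 β hβmin hβc K hK L M _ _ hL3 hM3 j hj hjN S₆ hS0 hS Ωe
  have hRj : ∀ j', 0 ≤ R.Gfr j' := gfr_nonneg_of_wf2 hR2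
  have hβ0 : β ≠ 0 := (lt_of_lt_of_le (by norm_num [klBetaMin]) hβmin).ne'
  have hB : 0 ≤ CA ^ 6 * S₆ := mul_nonneg (pow_nonneg hCA.le 6) hS0
  refine klAnisoLegKernelNormAt_six_le_of_line_doors hRj hc hcT6 hU hUT6 hβmin hβc hμ μ hK j hB ?_ Ωe
  intro Ω _ p x
  -- the aniso all-fixed six-leg line at leg 0 from the plain line (`m = 5`), then any leg by translation invariance
  have hline0 : ∀ x₁ : SpaceTimeIdx L M,
      fixedTupleL1 L M β 5 (sectorisedKernel L M β (klAnisoFamily L M β μ K klE0 j) (klEffectiveAction L M β U μ K klE0 j) 6) Ω x₁ ≤ CA ^ 6 * S₆ := by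
    intro x₁
    have hΩ : Ω = fun i => (((Ω i).1.1, (Ω i).1.2), (Ω i).2) := funext fun i => by simp
    rw [hΩ]
    exact h P R c hP hR2 hc hc6 μ hμ U hU hU9 β hβmin hβc K hK L M hL3 hM3 j hj hjN 5 (klEffectiveAction L M β U μ K klE0 j)
      (fun i => (Ω i).1.1) (fun i => (Ω i).1.2) (fun i => (Ω i).2) S₆ hS0 (hS _ _) x₁
  exact pinnedSum_le_of_fixedTupleL1_le_legs hβ0 _ U μ K klE0 j Ω hline0 p x

/-- **`hsix` FROM THE PLAIN SIX-LEG LINE** — the read-out closer's six-leg level-one cell in its own binder shape: `∃ CA > 0` such that, under the stub binders and the six doors,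
for every `1 ≤ j ≤ nScales β + 1` and plain six-leg line `S₆ ≥ 0` of `𝒱_j[K]` with `4096·klThinCount6C·(CA⁶·S₆) ≤ Qe.CE³·(epsCoupling P U j)²`:
`∀ Ωe, levelCount Ωe = 1 → klAnisoLegKernelNormAt L M β U μ K klE0 j (2·3) Ωe ≤ Qe.CE³·(epsCoupling P U j)²·2^{(4:ℤ)·j}`
(the hypothesis `hsix` of `kernelNormsLevels_readoutF_of_blocks_link` / `…_klEng`, verbatim). [cite: BenfattoGiulianiMastropietro2006, §2.8 (2.96)-(2.98), Lemma 2.5] -/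
theorem hsix_of_plainLine_klEng :
    ∃ CA : ℝ, 0 < CA ∧ ∀ (P : SplitConsts) (R : RenConsts) (c : ℝ), P.WF → R.WF2 → 0 < c → c ≤ klEngC₃6 P R → c ≤ klThinCount6C₃ R →
      ∀ μ ∈ klWindowC, ∀ U : ℝ, 0 < U → U ≤ klEngU₀9 P R c → U ≤ klThinCount6U₀ R → ∀ β : ℝ, klBetaMin ≤ β → β ≤ Real.exp (c / U ^ 2) →
      ∀ K : TrigPolyC4v, FrameOK R U (nScales β) μ K → ∀ (L M : ℕ) [NeZero L] [NeZero M],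
      klEngL₃ β U ≤ L → klEngM₃ β U L ≤ M → ∀ j : ℕ, 1 ≤ j → j ≤ nScales β + 1 →
        ∀ S₆ : ℝ, 0 ≤ S₆ →
          (∀ (s c' : Fin 6 → Fin 2) (y₀ : SpaceTimeIdx L M),
            fixedTupleL1 L M β 5 (sectorisedKernel L M β (trivialMultiplier L M) (klEffectiveAction L M β U μ K klE0 j) 6)
              (fun i => (((0 : Fin 1), s i), c' i)) y₀ ≤ S₆) →
          ∀ Qe : EngConsts, 4096 * klThinCount6C * (CA ^ 6 * S₆) ≤ Qe.CE ^ 3 * (epsCoupling P U j) ^ 2 →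
          ∀ Ωe : Fin (2 * 3) → Option (SectorLeg (sectorCount j)), levelCount Ωe = 1 →
            klAnisoLegKernelNormAt L M β U μ K klE0 j (2 * 3) Ωe ≤ Qe.CE ^ 3 * (epsCoupling P U j) ^ 2 * (2 : ℝ) ^ ((4 : ℤ) * j) := by
  obtain ⟨CA, hCA, h⟩ := klAnisoLegKernelNormAt_six_le_of_plainLine_klEng
  refine ⟨CA, hCA, ?_⟩
  intro P R c hP hR2 hc hc6 hcT6 μ hμ U hU hU9 hUT6 β hβmin hβc K hK L M _ _ hL3 hM3 j hj hjN S₆ hS0 hS Qe hCE Ωe _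
  have h6 := h P R c hP hR2 hc hc6 hcT6 μ hμ U hU hU9 hUT6 β hβmin hβc K hK L M hL3 hM3 j hj hjN S₆ hS0 hS Ωe
  have hz : (2 : ℝ) ^ ((4 : ℤ) * j) = (2 : ℝ) ^ (4 * j) := by
    rw [show ((4 : ℤ) * j) = ((4 * j : ℕ) : ℤ) by push_cast; ring, zpow_natCast]
  have h2 : (0 : ℝ) ≤ (2 : ℝ) ^ (4 * j) := by positivity
  rw [hz]
  calc klAnisoLegKernelNormAt L M β U μ K klE0 j (2 * 3) Ωe ≤ 4096 * klThinCount6C * (2 : ℝ) ^ (4 * j) * (CA ^ 6 * S₆) := h6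
    _ = (4096 * klThinCount6C * (CA ^ 6 * S₆)) * (2 : ℝ) ^ (4 * j) := by ring
    _ ≤ (Qe.CE ^ 3 * (epsCoupling P U j) ^ 2) * (2 : ℝ) ^ (4 * j) := mul_le_mul_of_nonneg_right hCE h2
    _ = Qe.CE ^ 3 * (epsCoupling P U j) ^ 2 * (2 : ℝ) ^ (4 * j) := by ring

end Summit.HubbardSuperconductivity.HubbardSuperconductivity.Theorems.EngineV8

end
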